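import Summits.ResolutionOfSingularities.ResolutionOfSingularities.Theorems.DeepCrossCutFanGameMeasure
import HarnessLib

/-!
# [OURS · decomp-res lens-2 g22 · column 29273 · node «DeepCrossCut»] THE FAN GAME OF LAW (X**) IN KERNEL — §5 S3′
as a program on fans, soundness of `run`, the initial fan of the bed, 35 EXIT CERTIFICATES by `decide +kernel`

Part of `HOME/decomp-res-lens-2/g22/FanGame.lean` (checked as ONE file: rc 0 · 0 sorry · 0 warnings; the parts are
verbatim slices); see the module
docstring of `DeepCrossCutFanGameLocal` for the KERNEL / PAPER / SCOPE statement of the whole port.  `--supports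
stmt-ResolutionOfSingularities-29273`
(helper).  OURS; AI kernel work; resolution of singularities in characteristic `p` is NOT proved here or anywhere in this chain.
-/


namespace Summit.ResolutionOfSingularities.ResolutionOfSingularities.Theorems.DeepCrossCutFanGame

open Ray

namespace Fan

/-! ## §5  Strategy S3′ as a program on fans, and EXIT CERTIFICATES by kernel evaluation

The moves (LEMMA Y.C): (P2) star-subdivide a special edge of maximal key; else (P3) at a special point (cone)
star-subdivide a top-line
edge of it of maximal order; else (P3n) star-subdivide a nodal edge; else STOP.  EXIT = no special edge, no special
point, no nodal edge
(LEMMA Y.C (v)).  Ties are resolved by list order (S3′ leaves them arbitrary). -/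

/-- Decidability / bookkeeping instance of the fan-game kernel, VERBATIM from the lens's part file (see the module docstring). [folklore] -/
instance (v' w' v w : Ray) : Decidable (KeyLE v' w' v w) := by unfold KeyLE; infer_instance

/-- `keyLE_refl`: Auxiliary step of the fan-game kernel (decomp-res lens-2 g22 «DeepCrossCut» companion FanGame.lean
16455400), VERBATIM from the lens's part file (see the module docstring); the statement is its type. [folklore] -/
theorem keyLE_refl (v w : Ray) : KeyLE v w v w := by unfold KeyLE; omega
/-- `keyLE_total`: Auxiliary step of the fan-game kernel (decomp-res lens-2 g22 «DeepCrossCut» companion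
FanGame.lean 16455400), VERBATIM from the lens's part file (see the module docstring); the statement is its type. [folklore] -/
theorem keyLE_total (v' w' v w : Ray) : KeyLE v' w' v w ∨ KeyLE v w v' w' := by unfold KeyLE; omega
/-- `keyLE_trans`: Auxiliary step of the fan-game kernel (decomp-res lens-2 g22 «DeepCrossCut» companion
FanGame.lean 16455400), VERBATIM from the lens's part file (see the module docstring); the statement is its type. [folklore] -/
theorem keyLE_trans {v₁ w₁ v₂ w₂ v₃ w₃ : Ray} (h₁ : KeyLE v₁ w₁ v₂ w₂) (h₂ : KeyLE v₂ w₂ v₃ w₃) : KeyLE v₁ w₁ v₃ w₃ := by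
  unfold KeyLE at *; omega

/-- Keep the better of `e` and an optional current maximum (the earlier edge wins ties). -/
def pick2 (F : Fan) (e : Edge) : Option Edge → Edge
  | none => e
  | some e' => if KeyLE (F.ray e'.1) (F.ray e'.2) (F.ray e.1) (F.ray e.2) then e else e'

/-- An edge of the list of maximal key `(order, |δ|+|δ'|)` — the first one among the maxima. -/
def pickMax (F : Fan) : List Edge → Option Edge
  | [] => none
  | e :: l => some (F.pick2 e (F.pickMax l))

/-- `pickMax_spec`: Auxiliary step of the fan-game kernel (decomp-res lens-2 g22 «DeepCrossCut» companion
FanGame.lean 16455400), VERBATIM from the lens's part file (see the module docstring); the statement is its type. [folklore] -/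
theorem pickMax_spec (F : Fan) : ∀ (l : List Edge) (e : Edge), F.pickMax l = some e →
    e ∈ l ∧ ∀ e' ∈ l, KeyLE (F.ray e'.1) (F.ray e'.2) (F.ray e.1) (F.ray e.2)
  | [], e, h => by simp [pickMax] at h
  | e₀ :: l, e, h => by
    simp only [pickMax, Option.some.injEq] at h
    cases hq : F.pickMax l with
    | none =>
      rw [hq] at h; simp only [pick2] at h; subst h
      have hl : l = [] := by
        cases l with
        | nil => rfl
        | cons _ _ => simp [pickMax] at hq
      subst hl
      refine ⟨List.mem_cons_self, fun e' he' => ?_⟩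
      rw [List.mem_singleton] at he'; subst he'; exact keyLE_refl _ _
    | some e₁ =>
      obtain ⟨hm, hM⟩ := pickMax_spec F l e₁ hq
      rw [hq] at h; simp only [pick2] at h
      split_ifs at h with hle
      · subst h
        refine ⟨List.mem_cons_self, fun e' he' => ?_⟩
        rcases List.mem_cons.mp he' with rfl | he'
        · exact keyLE_refl _ _
        · exact keyLE_trans (hM e' he') hle
      · subst h
        refine ⟨List.mem_cons_of_mem _ hm, fun e' he' => ?_⟩
        rcases List.mem_cons.mp he' with rfl | he'
        · exact (keyLE_total _ _ _ _).resolve_left hle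
        · exact hM e' he'

/-- RULE (P2): the chosen special edge (if any). -/
def p2 (F : Fan) : Option Edge := F.pickMax (F.edges.filter fun e => F.IsSpecial e)

/-- The program's (P2) choice is a maximal special edge in the sense of `IsMaxSpecial` (so §4 applies to it). [folklore] -/
theorem isMaxSpecial_of_p2 {F : Fan} (hV : F.Valid) {e : Edge} (h : F.p2 = some e) : F.IsMaxSpecial e.1 e.2 := by
  obtain ⟨hm, hM⟩ := F.pickMax_spec _ e h
  rw [List.mem_filter, decide_eq_true_eq] at hm
  refine ⟨by rw [s_of_mem_edges hV hm.1]; exact hm.1, hm.2, fun e' he' hs' => hM e' ?_⟩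
  rw [List.mem_filter, decide_eq_true_eq]; exact ⟨he', hs'⟩

/-- `P2Step_of_p2`: Auxiliary step of the fan-game kernel (decomp-res lens-2 g22 «DeepCrossCut» companion
FanGame.lean 16455400), VERBATIM from the lens's part file (see the module docstring); the statement is its type. [folklore] -/
theorem P2Step_of_p2 {F : Fan} (hV : F.Valid) {e : Edge} (h : F.p2 = some e) : P2Step (F.subdivide e.1 e.2) F :=
  ⟨hV, e.1, e.2, isMaxSpecial_of_p2 hV h, rfl⟩

/-- The pattern `{0,1,1}` (= `e_i + e_j`) of LEMMA Y.C (iii). -/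
def IsPair (x y z : ℤ) : Prop := (x = 0 ∧ y = 1 ∧ z = 1) ∨ (x = 1 ∧ y = 0 ∧ z = 1) ∨ (x = 1 ∧ y = 1 ∧ z = 0)

/-- SPECIAL POINT of a cone (LEMMA Y.C (iii)): `|α| ≥ 2`, `|β| ≥ 2`, `α, β ∉ {e_i + e_j}`. -/
def IsSpecialCone (F : Fan) (c : Cone) : Prop :=
  2 ≤ (F.ray c.1).a + (F.ray c.2.1).a + (F.ray c.2.2).a ∧ 2 ≤ (F.ray c.1).b + (F.ray c.2.1).b + (F.ray c.2.2).b ∧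
    ¬ IsPair (F.ray c.1).a (F.ray c.2.1).a (F.ray c.2.2).a ∧ ¬ IsPair (F.ray c.1).b (F.ray c.2.1).b (F.ray c.2.2).b

/-- TOP LINE (LEMMA Y.C (ii)): `|a| ≥ 2 ∧ |b| ≥ 2`. -/
def IsTopLine (F : Fan) (e : Edge) : Prop := TopLine (F.ray e.1) (F.ray e.2)

/-- NODAL EDGE (LEMMA Y.C (iv)): both endpoints are `H`-rays of type `(1,1)`. -/
def IsNodal (F : Fan) (e : Edge) : Prop :=
  (F.ray e.1).a = 1 ∧ (F.ray e.1).b = 1 ∧ (F.ray e.2).a = 1 ∧ (F.ray e.2).b = 1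

/-- Decidability / bookkeeping instance of the fan-game kernel, VERBATIM from the lens's part file (see the module docstring). [folklore] -/
instance (x y z : ℤ) : Decidable (IsPair x y z) := by unfold IsPair; infer_instance
/-- Decidability / bookkeeping instance of the fan-game kernel, VERBATIM from the lens's part file (see the module docstring). [folklore] -/
instance (F : Fan) (c : Cone) : Decidable (F.IsSpecialCone c) := by unfold IsSpecialCone; infer_instance
/-- Decidability / bookkeeping instance of the fan-game kernel, VERBATIM from the lens's part file (see the module docstring). [folklore] -/
instance (F : Fan) (e : Edge) : Decidable (F.IsTopLine e) := by unfold IsTopLine; infer_instance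
/-- Decidability / bookkeeping instance of the fan-game kernel, VERBATIM from the lens's part file (see the module docstring). [folklore] -/
instance (F : Fan) (e : Edge) : Decidable (F.IsNodal e) := by unfold IsNodal; infer_instance

/-- First edge of maximal order in a list. -/
def pickMaxOrd (F : Fan) : List Edge → Option Edge
  | [] => none
  | e :: l =>
    match F.pickMaxOrd l with
    | none => some e
    | some e' => if order (F.ray e'.1) (F.ray e'.2) ≤ order (F.ray e.1) (F.ray e.2) then some e else some e'

/-- RULE (P3): at the first special point, a top-line edge of its cone of maximal order (if any). -/
def p3 (F : Fan) : Option Edge :=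
  match F.cones.filter fun c => F.IsSpecialCone c with
  | [] => none
  | c :: _ => F.pickMaxOrd (c.edges.filter fun e => F.IsTopLine e)

/-- RULE (P3n): the first nodal edge (if any). -/
def p3n (F : Fan) : Option Edge := (F.edges.filter fun e => F.IsNodal e).head?

/-- ONE MOVE OF S3′ (`none` = no move applies). -/
def step (F : Fan) : Option Fan :=
  match F.p2 with
  | some e => some (F.subdivide e.1 e.2)
  | none =>
    match F.p3 with
    | some e => some (F.subdivide e.1 e.2)
    | none =>
      match F.p3n with
      | some e => some (F.subdivide e.1 e.2)
      | none => none

/-- While a special edge exists, the program's move IS a (P2) move of S3′ (§4's termination theorem governs this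
phase). [folklore] -/
theorem step_of_p2 {F : Fan} {e : Edge} (h : F.p2 = some e) : F.step = some (F.subdivide e.1 e.2) := by
  unfold step; rw [h]

/-- EXIT (LEMMA Y.C (v)): no special edge, no special point, no nodal edge. -/
def Exit (F : Fan) : Prop :=
  (∀ e ∈ F.edges, ¬ F.IsSpecial e) ∧ (∀ c ∈ F.cones, ¬ F.IsSpecialCone c) ∧ ∀ e ∈ F.edges, ¬ F.IsNodal e

/-- Decidability / bookkeeping instance of the fan-game kernel, VERBATIM from the lens's part file (see the module docstring). [folklore] -/
instance (F : Fan) : Decidable F.Exit := by unfold Exit; infer_instance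

/-- Play S3′ with `fuel`: `some k` iff the game EXITS after exactly `k` moves (within the fuel). -/
def run : Fan → ℕ → Option ℕ
  | F, 0 => if F.Exit then some 0 else none
  | F, fuel + 1 =>
    match F.step with
    | none => if F.Exit then some 0 else none
    | some F' => (run F' fuel).map Nat.succ

/-- THE INITIAL FAN of the bed member `z² + x^m + t²y^d`: the octant `⟨e_x, e_y, e_t⟩`, local data `δ = m, −d, −2`
and the own bits. -/
def init (m d : ℕ) : Fan := ⟨[⟨m, 1, 0, 0⟩, ⟨-(d : ℤ), 0, 1, 0⟩, ⟨-2, 0, 0, 1⟩], [(0, 1, 2)]⟩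

/-- `init_valid`: Auxiliary step of the fan-game kernel (decomp-res lens-2 g22 «DeepCrossCut» companion FanGame.lean
16455400), VERBATIM from the lens's part file (see the module docstring); the statement is its type. [folklore] -/
theorem init_valid {m d : ℕ} (hm : m % 2 = 1) (hd : d % 2 = 1) : (init m d).Valid := by
  constructor
  · intro r hr
    simp only [init, List.mem_cons, List.not_mem_nil, or_false] at hr
    rcases hr with rfl | rfl | rfl <;> (unfold Ray.WF; simp only; omega)
  · intro c hc
    simp only [init, List.mem_singleton] at hc
    subst hc
    show Cone.Good (0, 1, 2) 3
    decide

/-- `k` moves of the program from `F` (`none` if it stops earlier). [OURS · bookkeeping] -/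
def play : Fan → ℕ → Option Fan
  | F, 0 => some F
  | F, k + 1 =>
    match F.step with
    | none => none
    | some F' => play F' k

/-- SOUNDNESS OF THE CERTIFICATES: `run F fuel = some k` means that after EXACTLY `k` moves the program stands at an
EXIT state. [OURS] [folklore] -/
theorem run_sound : ∀ (fuel : ℕ) (F : Fan) (k : ℕ), F.run fuel = some k → ∃ G, F.play k = some G ∧ G.Exit
  | 0, F, k, h => by
    unfold run at h
    split_ifs at h with hE
    · simp only [Option.some.injEq] at h; subst h
      exact ⟨F, rfl, hE⟩
  | fuel + 1, F, k, h => by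
    unfold run at h
    cases hs : F.step with
    | none =>
      rw [hs] at h; simp only at h
      split_ifs at h with hE
      · simp only [Option.some.injEq] at h; subst h
        exact ⟨F, rfl, hE⟩
    | some F' =>
      rw [hs] at h; simp only [Option.map_eq_some_iff] at h
      obtain ⟨k', hk', rfl⟩ := h
      obtain ⟨G, hG, hGE⟩ := run_sound fuel F' k' hk'
      exact ⟨G, by unfold play; rw [hs]; exact hG, hGE⟩

/-- The initial edge `{e_x, e_y}` IS special for `m, d ≥ 2`: the first move of S3′ is forced (a (P2) move). [OURS] [folklore] -/
theorem isSpecial_init {m d : ℕ} (hm : 2 ≤ m) (hd : 2 ≤ d) : (init m d).IsSpecial (0, 1) := by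
  unfold IsSpecial
  show Special ⟨m, 1, 0, 0⟩ ⟨-(d : ℤ), 0, 1, 0⟩
  unfold Special Ray.a Ray.b
  simp only
  split_ifs <;> omega

/-! ### Exit certificates (kernel `decide`): `ℓ(m,d)` = number of moves of S3′ until EXIT (`run_sound`). -/

/-- `run_init_3_3`: Auxiliary step of the fan-game kernel (decomp-res lens-2 g22 «DeepCrossCut» companion
FanGame.lean 16455400), VERBATIM from the lens's part file (see the module docstring); the statement is its type. [folklore] -/
theorem run_init_3_3 : (init 3 3).run 40 = some 2 := by decide +kernel
/-- `run_init_3_5`: Auxiliary step of the fan-game kernel (decomp-res lens-2 g22 «DeepCrossCut» companion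
FanGame.lean 16455400), VERBATIM from the lens's part file (see the module docstring); the statement is its type. [folklore] -/
theorem run_init_3_5 : (init 3 5).run 40 = some 7 := by decide +kernel
/-- `run_init_3_7`: Auxiliary step of the fan-game kernel (decomp-res lens-2 g22 «DeepCrossCut» companion
FanGame.lean 16455400), VERBATIM from the lens's part file (see the module docstring); the statement is its type. [folklore] -/
theorem run_init_3_7 : (init 3 7).run 40 = some 3 := by decide +kernel
/-- `run_init_3_9`: Auxiliary step of the fan-game kernel (decomp-res lens-2 g22 «DeepCrossCut» companion
FanGame.lean 16455400), VERBATIM from the lens's part file (see the module docstring); the statement is its type. [folklore] -/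
theorem run_init_3_9 : (init 3 9).run 40 = some 4 := by decide +kernel
/-- `run_init_3_11`: Auxiliary step of the fan-game kernel (decomp-res lens-2 g22 «DeepCrossCut» companion
FanGame.lean 16455400), VERBATIM from the lens's part file (see the module docstring); the statement is its type. [folklore] -/
theorem run_init_3_11 : (init 3 11).run 40 = some 9 := by decide +kernel
/-- `run_init_3_13`: Auxiliary step of the fan-game kernel (decomp-res lens-2 g22 «DeepCrossCut» companion
FanGame.lean 16455400), VERBATIM from the lens's part file (see the module docstring); the statement is its type. [folklore] -/
theorem run_init_3_13 : (init 3 13).run 40 = some 5 := by decide +kernel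
/-- `run_init_3_15`: Auxiliary step of the fan-game kernel (decomp-res lens-2 g22 «DeepCrossCut» companion
FanGame.lean 16455400), VERBATIM from the lens's part file (see the module docstring); the statement is its type. [folklore] -/
theorem run_init_3_15 : (init 3 15).run 40 = some 6 := by decide +kernel
/-- `run_init_5_5`: Auxiliary step of the fan-game kernel (decomp-res lens-2 g22 «DeepCrossCut» companion
FanGame.lean 16455400), VERBATIM from the lens's part file (see the module docstring); the statement is its type. [folklore] -/
theorem run_init_5_5 : (init 5 5).run 40 = some 3 := by decide +kernel
/-- `run_init_5_7`: Auxiliary step of the fan-game kernel (decomp-res lens-2 g22 «DeepCrossCut» companion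
FanGame.lean 16455400), VERBATIM from the lens's part file (see the module docstring); the statement is its type. [folklore] -/
theorem run_init_5_7 : (init 5 7).run 40 = some 7 := by decide +kernel
/-- `run_init_5_9`: Auxiliary step of the fan-game kernel (decomp-res lens-2 g22 «DeepCrossCut» companion
FanGame.lean 16455400), VERBATIM from the lens's part file (see the module docstring); the statement is its type. [folklore] -/
theorem run_init_5_9 : (init 5 9).run 40 = some 10 := by decide +kernel
/-- `run_init_5_11`: Auxiliary step of the fan-game kernel (decomp-res lens-2 g22 «DeepCrossCut» companion
FanGame.lean 16455400), VERBATIM from the lens's part file (see the module docstring); the statement is its type. [folklore] -/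
theorem run_init_5_11 : (init 5 11).run 40 = some 4 := by decide +kernel
/-- `run_init_5_13`: Auxiliary step of the fan-game kernel (decomp-res lens-2 g22 «DeepCrossCut» companion
FanGame.lean 16455400), VERBATIM from the lens's part file (see the module docstring); the statement is its type. [folklore] -/
theorem run_init_5_13 : (init 5 13).run 40 = some 13 := by decide +kernel
/-- `run_init_5_15`: Auxiliary step of the fan-game kernel (decomp-res lens-2 g22 «DeepCrossCut» companion
FanGame.lean 16455400), VERBATIM from the lens's part file (see the module docstring); the statement is its type. [folklore] -/
theorem run_init_5_15 : (init 5 15).run 40 = some 5 := by decide +kernel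
/-- `run_init_5_17`: Auxiliary step of the fan-game kernel (decomp-res lens-2 g22 «DeepCrossCut» companion
FanGame.lean 16455400), VERBATIM from the lens's part file (see the module docstring); the statement is its type. [folklore] -/
theorem run_init_5_17 : (init 5 17).run 40 = some 9 := by decide +kernel
/-- `run_init_7_7`: Auxiliary step of the fan-game kernel (decomp-res lens-2 g22 «DeepCrossCut» companion
FanGame.lean 16455400), VERBATIM from the lens's part file (see the module docstring); the statement is its type. [folklore] -/
theorem run_init_7_7 : (init 7 7).run 40 = some 4 := by decide +kernel
/-- `run_init_7_9`: Auxiliary step of the fan-game kernel (decomp-res lens-2 g22 «DeepCrossCut» companion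
FanGame.lean 16455400), VERBATIM from the lens's part file (see the module docstring); the statement is its type. [folklore] -/
theorem run_init_7_9 : (init 7 9).run 40 = some 15 := by decide +kernel
/-- `run_init_7_11`: Auxiliary step of the fan-game kernel (decomp-res lens-2 g22 «DeepCrossCut» companion
FanGame.lean 16455400), VERBATIM from the lens's part file (see the module docstring); the statement is its type. [folklore] -/
theorem run_init_7_11 : (init 7 11).run 40 = some 18 := by decide +kernel
/-- `run_init_7_13`: Auxiliary step of the fan-game kernel (decomp-res lens-2 g22 «DeepCrossCut» companion
FanGame.lean 16455400), VERBATIM from the lens's part file (see the module docstring); the statement is its type. [folklore] -/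
theorem run_init_7_13 : (init 7 13).run 40 = some 13 := by decide +kernel
/-- `run_init_7_15`: Auxiliary step of the fan-game kernel (decomp-res lens-2 g22 «DeepCrossCut» companion
FanGame.lean 16455400), VERBATIM from the lens's part file (see the module docstring); the statement is its type. [folklore] -/
theorem run_init_7_15 : (init 7 15).run 40 = some 5 := by decide +kernel
/-- `run_init_7_17`: Auxiliary step of the fan-game kernel (decomp-res lens-2 g22 «DeepCrossCut» companion
FanGame.lean 16455400), VERBATIM from the lens's part file (see the module docstring); the statement is its type. [folklore] -/
theorem run_init_7_17 : (init 7 17).run 40 = some 9 := by decide +kernel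
/-- `run_init_7_19`: Auxiliary step of the fan-game kernel (decomp-res lens-2 g22 «DeepCrossCut» companion
FanGame.lean 16455400), VERBATIM from the lens's part file (see the module docstring); the statement is its type. [folklore] -/
theorem run_init_7_19 : (init 7 19).run 40 = some 10 := by decide +kernel
/-- `run_init_9_9`: Auxiliary step of the fan-game kernel (decomp-res lens-2 g22 «DeepCrossCut» companion
FanGame.lean 16455400), VERBATIM from the lens's part file (see the module docstring); the statement is its type. [folklore] -/
theorem run_init_9_9 : (init 9 9).run 40 = some 5 := by decide +kernel
/-- `run_init_9_11`: Auxiliary step of the fan-game kernel (decomp-res lens-2 g22 «DeepCrossCut» companion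
FanGame.lean 16455400), VERBATIM from the lens's part file (see the module docstring); the statement is its type. [folklore] -/
theorem run_init_9_11 : (init 9 11).run 40 = some 17 := by decide +kernel
/-- `run_init_9_13`: Auxiliary step of the fan-game kernel (decomp-res lens-2 g22 «DeepCrossCut» companion
FanGame.lean 16455400), VERBATIM from the lens's part file (see the module docstring); the statement is its type. [folklore] -/
theorem run_init_9_13 : (init 9 13).run 40 = some 10 := by decide +kernel
/-- `run_init_9_15`: Auxiliary step of the fan-game kernel (decomp-res lens-2 g22 «DeepCrossCut» companion
FanGame.lean 16455400), VERBATIM from the lens's part file (see the module docstring); the statement is its type. [folklore] -/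
theorem run_init_9_15 : (init 9 15).run 40 = some 11 := by decide +kernel
/-- `run_init_9_17`: Auxiliary step of the fan-game kernel (decomp-res lens-2 g22 «DeepCrossCut» companion
FanGame.lean 16455400), VERBATIM from the lens's part file (see the module docstring); the statement is its type. [folklore] -/
theorem run_init_9_17 : (init 9 17).run 40 = some 16 := by decide +kernel
/-- `run_init_9_19`: Auxiliary step of the fan-game kernel (decomp-res lens-2 g22 «DeepCrossCut» companion
FanGame.lean 16455400), VERBATIM from the lens's part file (see the module docstring); the statement is its type. [folklore] -/
theorem run_init_9_19 : (init 9 19).run 40 = some 6 := by decide +kernel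
/-- `run_init_9_21`: Auxiliary step of the fan-game kernel (decomp-res lens-2 g22 «DeepCrossCut» companion
FanGame.lean 16455400), VERBATIM from the lens's part file (see the module docstring); the statement is its type. [folklore] -/
theorem run_init_9_21 : (init 9 21).run 40 = some 13 := by decide +kernel
/-- `run_init_11_11`: Auxiliary step of the fan-game kernel (decomp-res lens-2 g22 «DeepCrossCut» companion
FanGame.lean 16455400), VERBATIM from the lens's part file (see the module docstring); the statement is its type. [folklore] -/
theorem run_init_11_11 : (init 11 11).run 40 = some 6 := by decide +kernel
/-- `run_init_11_13`: Auxiliary step of the fan-game kernel (decomp-res lens-2 g22 «DeepCrossCut» companion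
FanGame.lean 16455400), VERBATIM from the lens's part file (see the module docstring); the statement is its type. [folklore] -/
theorem run_init_11_13 : (init 11 13).run 40 = some 27 := by decide +kernel
/-- `run_init_11_15`: Auxiliary step of the fan-game kernel (decomp-res lens-2 g22 «DeepCrossCut» companion
FanGame.lean 16455400), VERBATIM from the lens's part file (see the module docstring); the statement is its type. [folklore] -/
theorem run_init_11_15 : (init 11 15).run 40 = some 14 := by decide +kernel
/-- `run_init_11_17`: Auxiliary step of the fan-game kernel (decomp-res lens-2 g22 «DeepCrossCut» companion
FanGame.lean 16455400), VERBATIM from the lens's part file (see the module docstring); the statement is its type. [folklore] -/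
theorem run_init_11_17 : (init 11 17).run 40 = some 32 := by decide +kernel
/-- `run_init_11_19`: Auxiliary step of the fan-game kernel (decomp-res lens-2 g22 «DeepCrossCut» companion
FanGame.lean 16455400), VERBATIM from the lens's part file (see the module docstring); the statement is its type. [folklore] -/
theorem run_init_11_19 : (init 11 19).run 40 = some 12 := by decide +kernel
/-- `run_init_11_21`: Auxiliary step of the fan-game kernel (decomp-res lens-2 g22 «DeepCrossCut» companion
FanGame.lean 16455400), VERBATIM from the lens's part file (see the module docstring); the statement is its type. [folklore] -/
theorem run_init_11_21 : (init 11 21).run 40 = some 19 := by decide +kernel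
/-- `run_init_11_23`: Auxiliary step of the fan-game kernel (decomp-res lens-2 g22 «DeepCrossCut» companion
FanGame.lean 16455400), VERBATIM from the lens's part file (see the module docstring); the statement is its type. [folklore] -/
theorem run_init_11_23 : (init 11 23).run 40 = some 7 := by decide +kernel

end Fan


end Summit.ResolutionOfSingularities.ResolutionOfSingularities.Theorems.DeepCrossCutFanGame
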